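import Mathlib.Analysis.Complex.CoveringMap
import Mathlib.Analysis.Complex.BranchLogRoot
import Mathlib.Analysis.Convex.Contractible
import Mathlib.Analysis.SpecialFunctions.Complex.CircleMap
import Mathlib.Analysis.SpecialFunctions.Complex.Log
import Mathlib.Topology.Homotopy.Lifting
import HarnessLib

/-!
# Continuous logarithms and the winding number of a loop in `ℂ \ {0}`

Topic: Topology / PlaneTopology (`Literature/Topology/PlaneTopology/`). This file is the first
of three proving the Jordan curve theorem (`Literature.Topology.PlaneTopology.JordanCurveTheorem`, `JordanCurve.lean`) by the
continuous-logarithm method of Borsuk and Eilenberg (S. Eilenberg, *Transformations continues en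
circonférence et la topologie du plan*, Fund. Math. **26** (1936)): a compact set `K ⊆ ℂ`
separates `a` from `b` iff `z ↦ (z - a)/(z - b)` has no continuous logarithm on `K`. Everything
here is elementary covering-space theory of `exp : ℂ → ℂ \ {0}` (Mathlib:
`Complex.isCoveringMap_exp`, `IsCoveringMap.liftHomotopy`, Hatcher Prop. 1.30) packaged for
plane topology:

* `HasLogOn f s`: `f : X → ℂ` has a continuous branch of `log f` on `s ⊆ X`; algebra of
  logarithms (`mul`, `inv`, `div`, `zpow`), the principal branch near `1`
  (`hasLogOn_of_norm_sub_lt`), uniqueness up to `2πiℤ` on preconnected sets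
  (`exists_int_eq_add_of_exp_eq`), gluing along open sets with preconnected intersection
  (`HasLogOn.union_of_isOpen`), and the **homotopy lifting property**: if `f ≃ g` through
  nonvanishing maps on `s` then `f` has a logarithm on `s` iff `g` does
  (`hasLogOn_iff_of_homotopy`).
* `hasLogOn_Icc`: a continuous nonvanishing `f : ℝ → ℂ` has a logarithm on every `[a, b]`
  (path lifting), and `hasLogOn_univ` on all of a simply connected space.
* `wind f : ℤ`, the **winding number about `0`** of the loop `f|[0,1]` (`f 0 = f 1`, `f ≠ 0`):
  `l 1 - l 0 = wind f · 2πi` for *every* logarithm `l` of `f` on `[0, 1]` (`wind_spec`);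
  additivity (`wind_mul`, `wind_zpow`), `wind f = 0 ↔ f` has a *periodic* logarithm
  (`wind_eq_zero_iff`), stability under perturbations smaller than `‖f‖`
  (`wind_eq_of_norm_sub_lt`, Rouché for loops), the model loops
  `circleLoop c R t = c + R e^{2πit}`: winding number `1` about interior points and `0` about
  exterior points (`wind_circleLoop_sub_of_norm_lt`, `wind_circleLoop_sub_of_lt_norm`), and
  `wind (F ∘ γ) = 0` whenever `F` has a logarithm on a set carrying the loop `γ`
  (`wind_comp_eq_zero_of_hasLogOn`).

Design: sets and `ContinuousOn` (not subtypes) so that the plane-topology files can move between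
`K`, `ℂ \ K`, arcs and circles freely; loops are maps `ℝ → ℂ` read on `[0, 1]`, matching the
`1`-periodic parametrisations of `Literature.Probability.RandomPlanarGeometry.JordanDomain` and `AddCircle (1 : ℝ)`.

## References
* S. Eilenberg, Transformations continues en circonférence et la topologie du plan, Fund. Math.
  26 (1936) 61–112. [Eilenberg1936]
* A. Hatcher, *Algebraic Topology*, CUP (2002), §1.1 and Prop. 1.30. [HatcherAT2002]
-/

noncomputable section

namespace Literature.Topology.PlaneTopology

open Complex Set _root_.Topology Filter
open scoped Real

variable {X : Type*} [TopologicalSpace X]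

/-! ### Continuous logarithms on a set -/

/-- `HasLogOn f s`: the map `f : X → ℂ` admits a **continuous logarithm** on `s`, i.e. there is
`g : X → ℂ` continuous on `s` with `exp (g x) = f x` for all `x ∈ s`. [folklore] -/
def HasLogOn (f : X → ℂ) (s : Set X) : Prop :=
  ∃ g : X → ℂ, ContinuousOn g s ∧ ∀ x ∈ s, exp (g x) = f x

namespace HasLogOn

variable {f g : X → ℂ} {s t : Set X}

/-- A map with a logarithm does not vanish. [folklore] -/
theorem ne_zero (h : HasLogOn f s) {x : X} (hx : x ∈ s) : f x ≠ 0 := by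
  obtain ⟨l, -, hl⟩ := h
  rw [← hl x hx]
  exact exp_ne_zero _

/-- A map with a continuous logarithm is continuous. [folklore] -/
theorem continuousOn (h : HasLogOn f s) : ContinuousOn f s := by
  obtain ⟨l, hl, hle⟩ := h
  exact (continuous_exp.comp_continuousOn hl).congr fun x hx => (hle x hx).symm

/-- Restriction. [folklore] -/
theorem mono (h : HasLogOn f t) (hst : s ⊆ t) : HasLogOn f s :=
  let ⟨l, hl, hle⟩ := h
  ⟨l, hl.mono hst, fun x hx => hle x (hst hx)⟩

/-- Invariance under change of the map on `s`. [folklore] -/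
theorem congr (h : HasLogOn f s) (hfg : EqOn f g s) : HasLogOn g s :=
  let ⟨l, hl, hle⟩ := h
  ⟨l, hl, fun x hx => (hle x hx).trans (hfg hx)⟩

/-- Logarithms add under products. [folklore] -/
theorem mul (hf : HasLogOn f s) (hg : HasLogOn g s) : HasLogOn (fun x => f x * g x) s := by
  obtain ⟨l, hl, hle⟩ := hf
  obtain ⟨m, hm, hme⟩ := hg
  exact ⟨fun x => l x + m x, hl.add hm, fun x hx => by rw [exp_add, hle x hx, hme x hx]⟩

/-- Logarithm of the inverse. [folklore] -/
theorem inv (hf : HasLogOn f s) : HasLogOn (fun x => (f x)⁻¹) s := by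
  obtain ⟨l, hl, hle⟩ := hf
  exact ⟨fun x => -l x, hl.neg, fun x hx => by rw [exp_neg, hle x hx]⟩

/-- Logarithm of a quotient. [folklore] -/
theorem div (hf : HasLogOn f s) (hg : HasLogOn g s) : HasLogOn (fun x => f x / g x) s := by
  simpa only [div_eq_mul_inv] using hf.mul hg.inv

/-- Logarithm of an integer power. [folklore] -/
theorem zpow (hf : HasLogOn f s) (n : ℤ) : HasLogOn (fun x => f x ^ n) s := by
  obtain ⟨l, hl, hle⟩ := hf
  refine ⟨fun x => n * l x, continuousOn_const.mul hl, fun x hx => ?_⟩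
  rw [exp_int_mul, hle x hx]

/-- Logarithm of a natural power. [folklore] -/
theorem pow (hf : HasLogOn f s) (n : ℕ) : HasLogOn (fun x => f x ^ n) s := by
  simpa using hf.zpow n

end HasLogOn

/-- A nonzero constant has a logarithm. [folklore] -/
theorem hasLogOn_const {c : ℂ} (hc : c ≠ 0) (s : Set X) : HasLogOn (fun _ : X => c) s :=
  ⟨fun _ => log c, continuousOn_const, fun _ _ => exp_log hc⟩

/-- Anything has a logarithm on the empty set. [folklore] -/
theorem hasLogOn_empty (f : X → ℂ) : HasLogOn f ∅ :=
  ⟨fun _ => 0, continuousOn_empty _, fun _ h => h.elim⟩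

/-- The principal branch: a continuous map with values in the disc `‖w - 1‖ < 1` has a continuous
logarithm. [folklore] -/
theorem hasLogOn_of_norm_sub_one_lt {f : X → ℂ} {s : Set X} (hf : ContinuousOn f s)
    (h : ∀ x ∈ s, ‖f x - 1‖ < 1) : HasLogOn f s := by
  refine ⟨fun x => log (f x), hf.clog fun x hx => ?_, fun x hx => exp_log ?_⟩
  · have := mem_slitPlane_of_norm_lt_one (h x hx)
    simpa using this
  · rintro h0
    have := h x hx
    rw [h0] at this
    simp at this

/-- **Rouché for logarithms.** If `‖f - g‖ < ‖g‖` on `s` and `g` has a continuous logarithm on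
`s`, so does the continuous map `f`. [folklore] -/
theorem hasLogOn_of_norm_sub_lt {f g : X → ℂ} {s : Set X} (hf : ContinuousOn f s)
    (hg : HasLogOn g s) (h : ∀ x ∈ s, ‖f x - g x‖ < ‖g x‖) : HasLogOn f s := by
  have hg0 : ∀ x ∈ s, g x ≠ 0 := fun x hx => hg.ne_zero hx
  have h1 : HasLogOn (fun x => f x / g x) s := by
    refine hasLogOn_of_norm_sub_one_lt (hf.div hg.continuousOn hg0) fun x hx => ?_
    rw [div_sub_one (hg0 x hx), norm_div, div_lt_one (norm_pos_iff.2 (hg0 x hx))]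
    exact h x hx
  refine (hg.mul h1).congr fun x hx => ?_
  simp only
  rw [mul_div_cancel₀ _ (hg0 x hx)]

/-- **Uniqueness of logarithms** on a preconnected set: two continuous logarithms of the same map
differ by a constant in `2πiℤ`. [folklore] -/
theorem exists_int_eq_add_of_exp_eq {l m : X → ℂ} {s : Set X} (hs : IsPreconnected s)
    (hl : ContinuousOn l s) (hm : ContinuousOn m s) (h : ∀ x ∈ s, exp (l x) = exp (m x)) :
    ∃ n : ℤ, ∀ x ∈ s, l x = m x + n * (2 * π * I) := by
  rcases s.eq_empty_or_nonempty with rfl | ⟨x₀, hx₀⟩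
  · exact ⟨0, fun x hx => hx.elim⟩
  obtain ⟨n, hn⟩ := exp_eq_exp_iff_exists_int.1 (h x₀ hx₀)
  refine ⟨n, fun x hx => ?_⟩
  have key := Complex.isCoveringMap_exp.eqOn_of_comp_eqOn hs hl
    (hm.add continuousOn_const) (g₂ := fun x => m x + n * (2 * π * I)) (fun y hy => ?_) hx₀ hn
  · exact key hx
  · simp only [Function.comp_apply, Subtype.mk.injEq]
    rw [exp_add, h y hy, exp_int_mul_two_pi_mul_I, mul_one]

/-- **Gluing logarithms along open sets.** If `f` has continuous logarithms on the open sets `U`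
and `V` and `U ∩ V` is preconnected, then `f` has a continuous logarithm on `U ∪ V` (adjust the
second logarithm by the constant difference on `U ∩ V`). [folklore] -/
theorem HasLogOn.union_of_isOpen {f : X → ℂ} {U V : Set X} (hU : IsOpen U) (hV : IsOpen V)
    (hUV : IsPreconnected (U ∩ V)) (hfU : HasLogOn f U) (hfV : HasLogOn f V) :
    HasLogOn f (U ∪ V) := by
  classical
  obtain ⟨l, hl, hle⟩ := hfU
  obtain ⟨m, hm, hme⟩ := hfV
  obtain ⟨n, hn⟩ := exists_int_eq_add_of_exp_eq hUV (hl.mono inter_subset_left)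
    (hm.mono inter_subset_right) fun x hx => by rw [hle x hx.1, hme x hx.2]
  let m' : X → ℂ := fun x => m x + n * (2 * π * I)
  have hm'c : ContinuousOn m' V := by
    show ContinuousOn (fun x => m x + n * (2 * π * I)) V
    fun_prop
  have hm'e : ∀ x ∈ V, exp (m' x) = f x := fun x hx => by
    show exp (m x + n * (2 * π * I)) = f x
    rw [exp_add, hme x hx, exp_int_mul_two_pi_mul_I, mul_one]
  refine ⟨U.piecewise l m', ?_, fun x hx => ?_⟩
  · rw [continuousOn_open_iff (hU.union hV)] at *
    intro t ht
    rw [continuousOn_open_iff hU] at hl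
    rw [continuousOn_open_iff hV] at hm'c
    -- `U.piecewise l m' ⁻¹' t` near points of `U` and of `V`
    have h1 : U ∩ U.piecewise l m' ⁻¹' t = U ∩ l ⁻¹' t := by
      ext x
      simp only [mem_inter_iff, mem_preimage, and_congr_right_iff]
      intro hx
      rw [piecewise_eq_of_mem _ _ _ hx]
    have h2 : V ∩ U.piecewise l m' ⁻¹' t = V ∩ m' ⁻¹' t := by
      ext x
      simp only [mem_inter_iff, mem_preimage, and_congr_right_iff]
      intro hx
      by_cases hxU : x ∈ U
      · rw [piecewise_eq_of_mem _ _ _ hxU, hn x ⟨hxU, hx⟩]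
      · rw [piecewise_eq_of_notMem _ _ _ hxU]
    have : (U ∪ V) ∩ U.piecewise l m' ⁻¹' t = (U ∩ l ⁻¹' t) ∪ (V ∩ m' ⁻¹' t) := by
      rw [union_inter_distrib_right, h1, h2]
    rw [this]
    exact (hl t ht).union (hm'c t ht)
  · by_cases hxU : x ∈ U
    · rw [piecewise_eq_of_mem _ _ _ hxU, hle x hxU]
    · rw [piecewise_eq_of_notMem _ _ _ hxU, hm'e x (hx.resolve_left hxU)]

/-! ### Homotopy invariance (the homotopy lifting property of `exp`) -/

/-- **Homotopy lifting for `exp`.** Let `H : [0, 1] × s → ℂ \ {0}` be a homotopy (jointly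
continuous) from `f` to `g`. If `f` has a continuous logarithm on `s`, so does `g`. This is the
homotopy lifting property of the covering map `exp : ℂ → ℂ \ {0}` (Hatcher, Prop. 1.30;
Mathlib `IsCoveringMap.liftHomotopy`). [cite: HatcherAT2002, Prop. 1.30] -/
theorem HasLogOn.of_homotopy {f g : X → ℂ} {s : Set X} (H : ℝ → X → ℂ)
    (hH : ContinuousOn (fun p : ℝ × X => H p.1 p.2) (Icc 0 1 ×ˢ s))
    (h0 : ∀ x ∈ s, H 0 x = f x) (h1 : ∀ x ∈ s, H 1 x = g x)
    (hne : ∀ t ∈ Icc (0 : ℝ) 1, ∀ x ∈ s, H t x ≠ 0) (hf : HasLogOn f s) : HasLogOn g s := by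
  classical
  obtain ⟨l, hl, hle⟩ := hf
  set p : ℂ → {z : ℂ // z ≠ 0} := fun z => ⟨exp z, exp_ne_zero z⟩ with hp
  have cov : IsCoveringMap p := Complex.isCoveringMap_exp
  have hcont : Continuous fun q : unitInterval × s => H (q.1 : ℝ) (q.2 : X) := by
    have h' : Continuous fun q : unitInterval × s => ((q.1 : ℝ), (q.2 : X)) := by fun_prop
    exact hH.comp_continuous h' fun q => ⟨q.1.2, q.2.2⟩
  let Hc : C(unitInterval × s, {z : ℂ // z ≠ 0}) :=
    ⟨fun q => ⟨H q.1 q.2, hne _ q.1.2 _ q.2.2⟩, hcont.subtype_mk _⟩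
  let fc : C(s, ℂ) := ⟨fun a => l a, hl.restrict⟩
  have H0 : ∀ a, Hc (0, a) = p (fc a) := fun a =>
    Subtype.ext (by simp [Hc, fc, hp, h0 _ a.2, hle _ a.2])
  set L := cov.liftHomotopy Hc fc H0 with hL
  have hLe : ∀ q, exp (L q) = H q.1 q.2 := fun q =>
    congrArg Subtype.val (congr_fun (cov.liftHomotopy_lifts Hc fc H0) q)
  refine ⟨fun x => if hx : x ∈ s then L (1, ⟨x, hx⟩) else 0, ?_, fun x hx => ?_⟩
  · rw [continuousOn_iff_continuous_restrict]
    have : (s.restrict fun x => if hx : x ∈ s then L (1, ⟨x, hx⟩) else 0) = fun a => L (1, a) := by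
      ext a
      simp [a.2]
    rw [this]
    fun_prop
  · simp only [hx, dif_pos]
    rw [hLe]
    exact h1 x hx

/-- **Homotopy invariance of having a logarithm**: for a homotopy `H : [0, 1] × s → ℂ \ {0}`
from `f` to `g`, `f` has a continuous logarithm on `s` iff `g` does. [cite: HatcherAT2002, Prop. 1.30] -/
theorem hasLogOn_iff_of_homotopy {f g : X → ℂ} {s : Set X} (H : ℝ → X → ℂ)
    (hH : ContinuousOn (fun p : ℝ × X => H p.1 p.2) (Icc 0 1 ×ˢ s))
    (h0 : ∀ x ∈ s, H 0 x = f x) (h1 : ∀ x ∈ s, H 1 x = g x)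
    (hne : ∀ t ∈ Icc (0 : ℝ) 1, ∀ x ∈ s, H t x ≠ 0) : HasLogOn f s ↔ HasLogOn g s := by
  refine ⟨HasLogOn.of_homotopy H hH h0 h1 hne, HasLogOn.of_homotopy (fun t => H (1 - t)) ?_
    (by simpa using h1) (by simpa using h0) fun t ht x hx => hne _ ⟨?_, ?_⟩ x hx⟩
  · have h' : ContinuousOn (fun p : ℝ × X => (1 - p.1, p.2)) (Icc 0 1 ×ˢ s) := by fun_prop
    refine hH.comp h' ?_
    rintro ⟨t, x⟩ ⟨ht, hx⟩
    exact ⟨⟨by linarith [ht.2], by linarith [ht.1]⟩, hx⟩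
  · linarith [ht.2]
  · linarith [ht.1]

/-! ### Logarithms on simply connected spaces and on intervals -/

/-- `ℝ` is simply connected. [folklore] -/
theorem isSimplyConnected_univ_real : IsSimplyConnected (univ : Set ℝ) := by
  have : ContractibleSpace (univ : Set ℝ) := (convex_univ).contractibleSpace ⟨0, trivial⟩
  change SimplyConnectedSpace (univ : Set ℝ)
  infer_instance

/-- `ℂ` is simply connected. [folklore] -/
theorem isSimplyConnected_univ_complex : IsSimplyConnected (univ : Set ℂ) := by
  have : ContractibleSpace (univ : Set ℂ) := (convex_univ).contractibleSpace ⟨0, trivial⟩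
  change SimplyConnectedSpace (univ : Set ℂ)
  infer_instance

/-- A continuous nowhere-vanishing map on a simply connected, locally path-connected space has a
continuous logarithm (Mathlib's `Complex.exists_continuousOn_eqOn_exp_comp`). [folklore] -/
theorem hasLogOn_univ {Y : Type*} [TopologicalSpace Y] [LocallyPathConnectedSpace Y]
    (hY : IsSimplyConnected (univ : Set Y)) {f : Y → ℂ} (hf : Continuous f)
    (hne : ∀ y, f y ≠ 0) : HasLogOn f univ := by
  obtain ⟨g, hg, hge⟩ := Complex.exists_continuousOn_eqOn_exp_comp hY isOpen_univ
    hf.continuousOn (by simpa using fun y => (hne y))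
  exact ⟨g, hg, fun x hx => hge hx⟩

/-- **Path lifting.** A map `f : ℝ → ℂ` continuous and nonvanishing on `[a, b]` has a
continuous logarithm on `[a, b]`. [folklore] -/
theorem hasLogOn_Icc {f : ℝ → ℂ} {a b : ℝ} (hf : ContinuousOn f (Icc a b))
    (hne : ∀ t ∈ Icc a b, f t ≠ 0) : HasLogOn f (Icc a b) := by
  rcases le_or_gt a b with hab | hab
  · have key : HasLogOn (fun t => f (projIcc a b hab t : ℝ)) univ :=
      hasLogOn_univ isSimplyConnected_univ_real
        (hf.comp_continuous (continuous_subtype_val.comp continuous_projIcc)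
          fun t => (projIcc a b hab t).2)
        fun t => hne _ (projIcc a b hab t).2
    refine (key.mono (subset_univ _)).congr fun t ht => ?_
    simp [projIcc_of_mem hab ht]
  · rw [Icc_eq_empty_of_lt hab]
    exact hasLogOn_empty f

/-! ### The winding number of a loop -/

/-- Two integers with equal multiples of `2πi` are equal. [folklore] -/
theorem int_eq_of_mul_two_pi_I_eq {m n : ℤ} (h : (m : ℂ) * (2 * π * I) = n * (2 * π * I)) :
    m = n := by
  have h2 : (2 * π * I : ℂ) ≠ 0 := by simp [Real.pi_ne_zero, I_ne_zero]
  exact_mod_cast mul_right_cancel₀ h2 h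

/-- For a loop `f` (`f 0 = f 1`) with a logarithm on `[0, 1]` there is one integer `n` with
`l 1 - l 0 = 2πi n` for every continuous logarithm `l` of `f` on `[0, 1]`. [folklore] -/
theorem exists_int_forall_log_sub_eq {f : ℝ → ℂ} (hf : HasLogOn f (Icc 0 1)) (h01 : f 0 = f 1) :
    ∃ n : ℤ, ∀ l : ℝ → ℂ, ContinuousOn l (Icc 0 1) → (∀ t ∈ Icc (0 : ℝ) 1, exp (l t) = f t) →
      l 1 - l 0 = n * (2 * π * I) := by
  obtain ⟨l₀, hl₀, hle₀⟩ := hf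
  have h0 : (0 : ℝ) ∈ Icc (0 : ℝ) 1 := ⟨le_rfl, zero_le_one⟩
  have h1 : (1 : ℝ) ∈ Icc (0 : ℝ) 1 := ⟨zero_le_one, le_rfl⟩
  obtain ⟨n, hn⟩ : ∃ n : ℤ, l₀ 1 = l₀ 0 + n * (2 * π * I) :=
    exp_eq_exp_iff_exists_int.1 (by rw [hle₀ 1 h1, hle₀ 0 h0, h01])
  refine ⟨n, fun l hl hle => ?_⟩
  obtain ⟨m, hm⟩ := exists_int_eq_add_of_exp_eq isPreconnected_Icc hl hl₀
    fun t ht => by rw [hle t ht, hle₀ t ht]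
  rw [hm 1 h1, hm 0 h0, hn]
  ring

/-- The **winding number about `0`** of the loop `f|[0,1]` (`f : ℝ → ℂ` continuous and
nonvanishing on `[0, 1]` with `f 0 = f 1`): the integer `n` with `l 1 - l 0 = 2πi n` for any
continuous logarithm `l` of `f` on `[0, 1]` (junk value `0` if `f` is not such a loop).
Equivalently the degree of `f/‖f‖ : S¹ → S¹`, or `(2πi)⁻¹ ∮ dz/z` along `f` when `f` is
rectifiable. [folklore] -/
def wind (f : ℝ → ℂ) : ℤ := by
  classical
  exact if h : HasLogOn f (Icc 0 1) ∧ f 0 = f 1 then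
    (exists_int_forall_log_sub_eq h.1 h.2).choose else 0

/-- **Characterisation of the winding number**: every continuous logarithm `l` of a loop `f` on
`[0, 1]` satisfies `l 1 - l 0 = 2πi · wind f`. [folklore] -/
theorem wind_spec {f l : ℝ → ℂ} (hl : ContinuousOn l (Icc 0 1))
    (hle : ∀ t ∈ Icc (0 : ℝ) 1, exp (l t) = f t) (h01 : f 0 = f 1) :
    l 1 - l 0 = wind f * (2 * π * I) := by
  have h : HasLogOn f (Icc 0 1) ∧ f 0 = f 1 := ⟨⟨l, hl, hle⟩, h01⟩
  rw [wind, dif_pos h]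
  exact (exists_int_forall_log_sub_eq h.1 h.2).choose_spec l hl hle

/-- A **loop in `ℂ \ {0}`** read on `[0, 1]`: continuous and nonvanishing on `[0, 1]` with
`f 0 = f 1`. [folklore] -/
structure IsNonvanishingLoop (f : ℝ → ℂ) : Prop where
  continuousOn : ContinuousOn f (Icc 0 1)
  ne_zero : ∀ t ∈ Icc (0 : ℝ) 1, f t ≠ 0
  eq_endpoints : f 0 = f 1

namespace IsNonvanishingLoop

variable {f g : ℝ → ℂ}

/-- A loop in `ℂ \ {0}` has a logarithm on `[0, 1]`. [folklore] -/
theorem hasLogOn (hf : IsNonvanishingLoop f) : HasLogOn f (Icc 0 1) :=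
  hasLogOn_Icc hf.continuousOn hf.ne_zero

/-- Products of loops. [folklore] -/
theorem mul (hf : IsNonvanishingLoop f) (hg : IsNonvanishingLoop g) :
    IsNonvanishingLoop (fun t => f t * g t) :=
  ⟨hf.continuousOn.mul hg.continuousOn, fun t ht => mul_ne_zero (hf.ne_zero t ht) (hg.ne_zero t ht),
    by rw [hf.eq_endpoints, hg.eq_endpoints]⟩

/-- Inverses of loops. [folklore] -/
theorem inv (hf : IsNonvanishingLoop f) : IsNonvanishingLoop (fun t => (f t)⁻¹) :=
  ⟨hf.continuousOn.inv₀ hf.ne_zero, fun t ht => inv_ne_zero (hf.ne_zero t ht),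
    by rw [hf.eq_endpoints]⟩

/-- Quotients of loops. [folklore] -/
theorem div (hf : IsNonvanishingLoop f) (hg : IsNonvanishingLoop g) :
    IsNonvanishingLoop (fun t => f t / g t) := by
  simpa only [div_eq_mul_inv] using hf.mul hg.inv

/-- Integer powers of loops. [folklore] -/
theorem zpow (hf : IsNonvanishingLoop f) (n : ℤ) : IsNonvanishingLoop (fun t => f t ^ n) :=
  ⟨hf.continuousOn.zpow₀ n fun t ht => Or.inl (hf.ne_zero t ht),
    fun t ht => zpow_ne_zero n (hf.ne_zero t ht), by rw [hf.eq_endpoints]⟩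

/-- Loops are stable under modification off `[0, 1]`. [folklore] -/
theorem congr (hf : IsNonvanishingLoop f) (h : EqOn f g (Icc 0 1)) : IsNonvanishingLoop g :=
  ⟨hf.continuousOn.congr h.symm, fun t ht => h ht ▸ hf.ne_zero t ht, by
    rw [← h ⟨le_rfl, zero_le_one⟩, ← h ⟨zero_le_one, le_rfl⟩, hf.eq_endpoints]⟩

/-- Nonzero constants are loops. [folklore] -/
theorem const {c : ℂ} (hc : c ≠ 0) : IsNonvanishingLoop fun _ : ℝ => c :=
  ⟨continuousOn_const, fun _ _ => hc, rfl⟩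

end IsNonvanishingLoop

/-- The winding number only depends on the loop on `[0, 1]`. [folklore] -/
theorem wind_congr {f g : ℝ → ℂ} (h : EqOn f g (Icc 0 1)) : wind f = wind g := by
  have h0 : (0 : ℝ) ∈ Icc (0 : ℝ) 1 := ⟨le_rfl, zero_le_one⟩
  have h1 : (1 : ℝ) ∈ Icc (0 : ℝ) 1 := ⟨zero_le_one, le_rfl⟩
  by_cases hf : HasLogOn f (Icc 0 1) ∧ f 0 = f 1
  · obtain ⟨l, hl, hle⟩ := hf.1
    have e1 := wind_spec hl hle hf.2
    have e2 := wind_spec hl (fun t ht => (hle t ht).trans (h ht)) (by rw [← h h0, ← h h1, hf.2])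
    exact int_eq_of_mul_two_pi_I_eq (e1.symm.trans e2)
  · have hg : ¬ (HasLogOn g (Icc 0 1) ∧ g 0 = g 1) := fun hg =>
      hf ⟨hg.1.congr h.symm, by rw [h h0, h h1, hg.2]⟩
    rw [wind, dif_neg hf, wind, dif_neg hg]

/-- **`wind f = 0` iff `f` has a periodic logarithm** (`l 0 = l 1`) on `[0, 1]`. [folklore] -/
theorem wind_eq_zero_iff {f : ℝ → ℂ} (hf : IsNonvanishingLoop f) :
    wind f = 0 ↔ ∃ l : ℝ → ℂ, ContinuousOn l (Icc 0 1) ∧ (∀ t ∈ Icc (0 : ℝ) 1, exp (l t) = f t) ∧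
      l 0 = l 1 := by
  constructor
  · intro h
    obtain ⟨l, hl, hle⟩ := hf.hasLogOn
    refine ⟨l, hl, hle, ?_⟩
    have := wind_spec hl hle hf.eq_endpoints
    rw [h, Int.cast_zero, zero_mul, sub_eq_zero] at this
    exact this.symm
  · rintro ⟨l, hl, hle, h⟩
    have := wind_spec hl hle hf.eq_endpoints
    rw [h, sub_self, eq_comm, mul_eq_zero] at this
    have h2 : (2 * π * I : ℂ) ≠ 0 := by simp [Real.pi_ne_zero, I_ne_zero]
    exact_mod_cast this.resolve_right h2

/-- The exponential of a periodic continuous function has winding number `0`. [folklore] -/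
theorem wind_exp_eq_zero {l : ℝ → ℂ} (hl : ContinuousOn l (Icc 0 1)) (h : l 0 = l 1) :
    wind (fun t => exp (l t)) = 0 :=
  (wind_eq_zero_iff ⟨continuous_exp.comp_continuousOn hl, fun t _ => exp_ne_zero _, by
    simp [h]⟩).2 ⟨l, hl, fun _ _ => rfl, h⟩

/-- Constants have winding number `0`. [folklore] -/
theorem wind_const (c : ℂ) : wind (fun _ : ℝ => c) = 0 := by
  by_cases hc : c = 0
  · have : ¬ (HasLogOn (fun _ : ℝ => c) (Icc 0 1) ∧ c = c) := fun h =>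
      h.1.ne_zero (x := 0) ⟨le_rfl, zero_le_one⟩ hc
    rw [wind, dif_neg this]
  · exact (wind_eq_zero_iff (IsNonvanishingLoop.const hc)).2
      ⟨fun _ => log c, continuousOn_const, fun _ _ => exp_log hc, rfl⟩

/-- **Additivity**: `wind (f g) = wind f + wind g`. [folklore] -/
theorem wind_mul {f g : ℝ → ℂ} (hf : IsNonvanishingLoop f) (hg : IsNonvanishingLoop g) :
    wind (fun t => f t * g t) = wind f + wind g := by
  obtain ⟨l, hl, hle⟩ := hf.hasLogOn
  obtain ⟨m, hm, hme⟩ := hg.hasLogOn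
  have e1 := wind_spec hl hle hf.eq_endpoints
  have e2 := wind_spec hm hme hg.eq_endpoints
  have e3 := wind_spec (f := fun t => f t * g t) (l := fun t => l t + m t) (hl.add hm)
    (fun t ht => by rw [exp_add, hle t ht, hme t ht]) (hf.mul hg).eq_endpoints
  apply int_eq_of_mul_two_pi_I_eq
  rw [Int.cast_add, add_mul, ← e1, ← e2, ← e3]
  ring

/-- `wind f⁻¹ = - wind f`. [folklore] -/
theorem wind_inv {f : ℝ → ℂ} (hf : IsNonvanishingLoop f) : wind (fun t => (f t)⁻¹) = -wind f := by
  have h := wind_mul hf hf.inv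
  have h1 : wind (fun t => f t * (f t)⁻¹) = 0 := by
    rw [wind_congr (g := fun _ => (1 : ℂ)) fun t ht => mul_inv_cancel₀ (hf.ne_zero t ht)]
    exact wind_const 1
  omega

/-- `wind (f / g) = wind f - wind g`. [folklore] -/
theorem wind_div {f g : ℝ → ℂ} (hf : IsNonvanishingLoop f) (hg : IsNonvanishingLoop g) :
    wind (fun t => f t / g t) = wind f - wind g := by
  simp only [div_eq_mul_inv]
  rw [wind_mul hf hg.inv, wind_inv hg]
  ring

/-- `wind (f ^ n) = n · wind f` for `n : ℤ`. [folklore] -/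
theorem wind_zpow {f : ℝ → ℂ} (hf : IsNonvanishingLoop f) (n : ℤ) :
    wind (fun t => f t ^ n) = n * wind f := by
  obtain ⟨l, hl, hle⟩ := hf.hasLogOn
  have e1 := wind_spec hl hle hf.eq_endpoints
  have e2 := wind_spec (f := fun t => f t ^ n) (l := fun t => n * l t) (continuousOn_const.mul hl)
    (fun t ht => by rw [exp_int_mul, hle t ht]) (hf.zpow n).eq_endpoints
  apply int_eq_of_mul_two_pi_I_eq
  rw [Int.cast_mul, ← e2, show (n : ℂ) * wind f * (2 * π * I) = n * (wind f * (2 * π * I)) by ring,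
    ← e1]
  ring

/-- **Rouché's principle for loops**: if `‖f - g‖ < ‖g‖` on `[0, 1]` then `wind f = wind g`
(`f/g` takes values in `‖w - 1‖ < 1`, where the principal logarithm is continuous). [folklore] -/
theorem wind_eq_of_norm_sub_lt {f g : ℝ → ℂ} (hf : ContinuousOn f (Icc 0 1)) (hf01 : f 0 = f 1)
    (hg : IsNonvanishingLoop g) (h : ∀ t ∈ Icc (0 : ℝ) 1, ‖f t - g t‖ < ‖g t‖) :
    wind f = wind g := by
  have hf0 : ∀ t ∈ Icc (0 : ℝ) 1, f t ≠ 0 := fun t ht h0 => by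
    have := h t ht
    rw [h0, zero_sub, norm_neg] at this
    exact lt_irrefl _ this
  have hfl : IsNonvanishingLoop f := ⟨hf, hf0, hf01⟩
  -- the quotient loop `f/g` has a periodic principal logarithm
  have hq : IsNonvanishingLoop fun t => f t / g t := hfl.div hg
  have hmem : ∀ t ∈ Icc (0 : ℝ) 1, f t / g t ∈ slitPlane := fun t ht => by
    have h1 : ‖f t / g t - 1‖ < 1 := by
      rw [div_sub_one (hg.ne_zero t ht), norm_div, div_lt_one (norm_pos_iff.2 (hg.ne_zero t ht))]
      exact h t ht
    have := mem_slitPlane_of_norm_lt_one h1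
    simpa using this
  have hw : wind (fun t => f t / g t) = 0 := by
    refine (wind_eq_zero_iff hq).2 ⟨fun t => log (f t / g t), hq.continuousOn.clog hmem,
      fun t ht => exp_log (hq.ne_zero t ht), ?_⟩
    simp only
    rw [hf01, hg.eq_endpoints]
  have := wind_div hfl hg
  omega

/-- If `F` has a continuous logarithm on a set `S` carrying the loop `γ`, then
`wind (F ∘ γ) = 0`. [folklore] -/
theorem wind_comp_eq_zero_of_hasLogOn {F : X → ℂ} {S : Set X} {γ : ℝ → X} (hF : HasLogOn F S)
    (hγ : ContinuousOn γ (Icc 0 1)) (hγS : MapsTo γ (Icc 0 1) S) (h01 : γ 0 = γ 1) :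
    wind (F ∘ γ) = 0 := by
  have hFc := hF.continuousOn
  have hF0 : ∀ x ∈ S, F x ≠ 0 := fun x hx => hF.ne_zero hx
  obtain ⟨L, hL, hLe⟩ := hF
  have hloop : IsNonvanishingLoop (F ∘ γ) :=
    ⟨hFc.comp hγ hγS, fun t ht => hF0 _ (hγS ht), by simp [h01]⟩
  exact (wind_eq_zero_iff hloop).2 ⟨L ∘ γ, hL.comp hγ hγS, fun t ht => hLe _ (hγS ht), by simp [h01]⟩

/-! ### Model loops: circles -/

/-- The circle loop `t ↦ c + R e^{2πit}` of centre `c` and radius `R`, read on `[0, 1]`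
(Mathlib's `circleMap c R` reparametrised by `2π`). [folklore] -/
def circleLoop (c : ℂ) (R : ℝ) (t : ℝ) : ℂ := circleMap c R (2 * π * t)

/-- Explicit formula `circleLoop c R t = c + R e^{2πit}`. [folklore] -/
theorem circleLoop_apply (c : ℂ) (R t : ℝ) :
    circleLoop c R t = c + R * exp (2 * π * t * I) := by
  simp [circleLoop, circleMap]

/-- Continuity of circle loops. [folklore] -/
theorem continuous_circleLoop (c : ℂ) (R : ℝ) : Continuous (circleLoop c R) := by
  unfold circleLoop circleMap
  fun_prop

/-- Translating a circle loop translates its centre. [folklore] -/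
theorem circleLoop_sub (c a : ℂ) (R t : ℝ) : circleLoop c R t - a = circleLoop (c - a) R t := by
  simp only [circleLoop, circleMap]
  ring

/-- Circle loops close up on `[0, 1]`. [folklore] -/
theorem circleLoop_zero_eq (c : ℂ) (R : ℝ) : circleLoop c R 0 = circleLoop c R 1 := by
  rw [circleLoop_apply, circleLoop_apply, ofReal_zero, ofReal_one, mul_zero, zero_mul, exp_zero,
    mul_one, mul_one, exp_two_pi_mul_I, mul_one]

/-- A circle loop stays at distance `|R|` from its centre. [folklore] -/
theorem norm_circleLoop_sub_center (c : ℂ) (R t : ℝ) : ‖circleLoop c R t - c‖ = |R| := by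
  rw [circleLoop_sub, sub_self]
  simp [circleLoop, norm_circleMap_zero]

/-- A circle loop of radius `R ≥ 0` lies on the sphere of radius `R`. [folklore] -/
theorem circleLoop_mem_sphere (c : ℂ) {R : ℝ} (hR : 0 ≤ R) (t : ℝ) :
    circleLoop c R t ∈ Metric.sphere c R := by
  simpa [abs_of_nonneg hR] using norm_circleLoop_sub_center c R t

/-- A circle loop not passing through `0` is a loop in `ℂ \ {0}`. [folklore] -/
theorem isNonvanishingLoop_circleLoop {c : ℂ} {R : ℝ} (h : ‖c‖ ≠ |R|) :
    IsNonvanishingLoop (circleLoop c R) := by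
  refine ⟨(continuous_circleLoop c R).continuousOn, fun t _ h0 => h ?_, circleLoop_zero_eq c R⟩
  have := norm_circleLoop_sub_center c R t
  rwa [h0, zero_sub, norm_neg] at this

/-- **The unit of winding**: the circle `t ↦ R e^{2πit}` (`R > 0`) winds once about `0`; its
logarithm is `log R + 2πit`. [folklore] -/
theorem wind_circleLoop_zero {R : ℝ} (hR : 0 < R) : wind (circleLoop 0 R) = 1 := by
  have hl : ContinuousOn (fun t : ℝ => (Real.log R : ℂ) + 2 * π * t * I) (Icc 0 1) := by fun_prop
  have hle : ∀ t ∈ Icc (0 : ℝ) 1, exp ((Real.log R : ℂ) + 2 * π * t * I) = circleLoop 0 R t := by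
    intro t _
    rw [exp_add, circleLoop_apply, zero_add, ofReal_log hR.le, exp_log (by exact_mod_cast hR.ne')]
  have := wind_spec hl hle (circleLoop_zero_eq 0 R)
  apply int_eq_of_mul_two_pi_I_eq
  rw [← this]
  push_cast
  ring

/-- A circle loop winds once about every point of the open disc it bounds:
`wind (t ↦ c + R e^{2πit} - a) = 1` for `‖a - c‖ < R`. [folklore] -/
theorem wind_circleLoop_sub_of_norm_lt {c a : ℂ} {R : ℝ} (h : ‖a - c‖ < R) :
    wind (fun t => circleLoop c R t - a) = 1 := by
  have hR : 0 < R := (norm_nonneg _).trans_lt h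
  rw [← wind_circleLoop_zero hR]
  refine wind_eq_of_norm_sub_lt ((continuous_circleLoop c R).continuousOn.sub continuousOn_const)
    (by rw [circleLoop_zero_eq]) (isNonvanishingLoop_circleLoop (by simp [abs_of_pos hR, hR.ne]))
    fun t _ => ?_
  have e : circleLoop c R t - a - circleLoop 0 R t = c - a := by
    simp only [circleLoop, circleMap]
    ring
  rw [e, show circleLoop 0 R t = circleLoop 0 R t - 0 by simp, norm_circleLoop_sub_center,
    abs_of_pos hR, norm_sub_rev]
  exact h

/-- A circle loop does not wind about points outside its closed disc:
`wind (t ↦ c + R e^{2πit} - a) = 0` for `0 ≤ R < ‖a - c‖`. [folklore] -/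
theorem wind_circleLoop_sub_of_lt_norm {c a : ℂ} {R : ℝ} (hR : 0 ≤ R) (h : R < ‖a - c‖) :
    wind (fun t => circleLoop c R t - a) = 0 := by
  have hca : c - a ≠ 0 := by
    rw [sub_ne_zero]
    rintro rfl
    rw [sub_self, norm_zero] at h
    exact not_lt.2 hR h
  rw [← wind_const (c - a)]
  refine wind_eq_of_norm_sub_lt ((continuous_circleLoop c R).continuousOn.sub continuousOn_const)
    (by rw [circleLoop_zero_eq]) (IsNonvanishingLoop.const hca) fun t _ => ?_
  have e : circleLoop c R t - a - (c - a) = circleLoop c R t - c := by ring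
  rw [e, norm_circleLoop_sub_center, abs_of_nonneg hR, norm_sub_rev]
  exact h

end Literature.Topology.PlaneTopology
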